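import Literature.Geometry.GeometricMeasureTheory.CurrentsLipschitzRectifiable
import Literature.Geometry.GeometricMeasureTheory.PushforwardProductRectifiable
import HarnessLib

/-!
# Rectifiability of Lipschitz and admissible homotopy currents

Support file for the proof of the named fact
`Literature.Geometry.GeometricMeasureTheory.Federer1969_compactness_integralCurrents`
(Federer–Fleming compactness, [Federer1969, 4.2.17 (2)]), on the way to the deformation theorem
4.2.9: there the homotopy currents `H_u(σ_{i−1} ∘ τ_a, σ_i ∘ τ_a) ∂T` of the cubical retractions
must be rectifiable (so that `P` is an integral polyhedral chain, via constancy). Companion of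
`CurrentsLipschitzRectifiable.lean` (push-forwards); the smooth product case is the sibling
`Current.IsRectifiable.pushforward_prodInterval_top` (`PushforwardProductRectifiable.lean`,
Federer 4.1.30 for `h_#([0,1] × T)`).

* `Current.IsRectifiable.lipHomotopy_of_contDiffAt` — the Lipschitz homotopy current
  `H(F, G) X` (`CurrentsAdmissibleHomotopy.lean`) of a rectifiable normal `X` is rectifiable when
  `F, G` are smooth at the points of an open set containing `spt X` (cut the clamped affine
  homotopy off to a smooth compactly supported map near `[0,1] × spt X`,
  `exists_contDiff_eqOn_nhds`; locality and cutoff-independence of the push-forward).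
* `Current.IsRectifiable.lipHomotopy_of_null` — the same when `F, G` are smooth off a closed
  `‖X‖`-null set (exhaustion `X ⌞ {dist(·, V ∖ O) > s}` at good levels, additivity
  `Current.lipHomotopy_add`, `𝐌(H(F,G) Y) ≤ c 𝐌(Y)`, `Current.IsRectifiable.of_tendsto_mass`).
* `Current.IsRectifiable.admHom`, `Current.support_admHom_subset`,
  `Current.IsRectifiable.admHomLim`, `Current.support_admHomLim_subset` — the admissible homotopy
  `H_v(g₁, g₂) S` of [Federer1969, 4.2.2] of a rectifiable `S` is rectifiable when `g₁, g₂` are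
  smooth off an `‖S‖`-null closed set and the segments `[g₁ x, g₂ x]` stay in a compact set; its
  support lies in any closed set containing these segments (an `ε`-thickening argument for the
  clamped homotopy slightly outside `[0,1]`).

Theorems only; no new definitions, no named facts.

## References

* H. Federer, *Geometric Measure Theory*, Springer 1969, 4.1.9, 4.1.24, 4.1.30, 4.2.2, 4.2.9
  (held copy `lit book:federernd-geometric-measure-theory`, PDF pp. 318–320, 327–328, 336–337,
  343–345) [Federer1969].
-/

noncomputable section

open scoped Distributions ENNReal NNReal Topology ContDiff InnerProductSpace
open MeasureTheory TopologicalSpace Set Filter Metric Function Module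

namespace Literature.Geometry.GeometricMeasureTheory

set_option maxSynthPendingDepth 2

section LipHomotopyRect

variable {V : Type*} [NormedAddCommGroup V] [InnerProductSpace ℝ V] [FiniteDimensional ℝ V]
  [MeasurableSpace V] [BorelSpace V] {m : ℕ}
  {V' : Type*} [NormedAddCommGroup V'] [InnerProductSpace ℝ V'] [FiniteDimensional ℝ V']
  [MeasurableSpace V'] [BorelSpace V']

omit [InnerProductSpace ℝ V] [FiniteDimensional ℝ V] [MeasurableSpace V] [BorelSpace V]
  [InnerProductSpace ℝ V'] [FiniteDimensional ℝ V'] [MeasurableSpace V'] [BorelSpace V'] in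
/-- The clamped affine homotopy is smooth at points `(t, x)` with `|t| < 2` where `F, G` are smooth.
[folklore] -/
theorem contDiffAt_lipHomotopyMap [NormedSpace ℝ V] [NormedSpace ℝ V'] {F G : V → V'} {p : ℝ × V}
    (ht : p.1 ∈ Set.Ioo (-2 : ℝ) 2) (hF : ContDiffAt ℝ ∞ F p.2) (hG : ContDiffAt ℝ ∞ G p.2) :
    ContDiffAt ℝ ∞ (lipHomotopyMap F G) p := by
  have heq : lipHomotopyMap F G =ᶠ[𝓝 p] affineHomotopy F G := by
    have hO : IsOpen (Set.Ioo (-2 : ℝ) 2 ×ˢ (Set.univ : Set V)) := isOpen_Ioo.prod isOpen_univ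
    filter_upwards [hO.mem_nhds ⟨ht, Set.mem_univ _⟩] with q hq
    exact lipHomotopyMap_eq_affineHomotopy F G (abs_le.2 ⟨hq.1.1.le, hq.1.2.le⟩)
  refine ContDiffAt.congr_of_eventuallyEq ?_ heq
  unfold affineHomotopy
  have h2 : ContDiffAt ℝ ∞ (fun q : ℝ × V => F q.2) p := hF.comp p contDiffAt_snd
  have h3 : ContDiffAt ℝ ∞ (fun q : ℝ × V => G q.2) p := hG.comp p contDiffAt_snd
  exact h2.add (contDiffAt_fst.smul (h3.sub h2))

/-- **The Lipschitz homotopy current of a rectifiable current is rectifiable when `F, G` are smooth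
near the support**: `H(F, G) X ∈ 𝓡` for `X ∈ 𝓡` normal with compact support and Lipschitz `F, G`
smooth at every point of an open `O ⊇ spt X` (cut the clamped homotopy off to a smooth compactly
supported map near `[0,1] × spt X`, `Current.IsRectifiable.pushforward_prodInterval_top`).
[cite: Federer1969, 4.1.9, 4.1.30] -/
theorem Current.IsRectifiable.lipHomotopy_of_contDiffAt {X : Current (⊤ : Opens V) (m + 1)}
    (hXr : X.IsRectifiable) (hX : X.mass ≠ ⊤) (hdX : X.boundary.mass ≠ ⊤) (hsupp : IsCompact X.support)
    {F G : V → V'} {LF LG : ℝ≥0} (hF : LipschitzWith LF F) (hG : LipschitzWith LG G)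
    {η : ℝ} (hη : 0 ≤ η) (hclose : ∀ x, ‖G x - F x‖ ≤ η)
    {O : Set V} (hO : IsOpen O) (hFO : ∀ x ∈ O, ContDiffAt ℝ ∞ F x) (hGO : ∀ x ∈ O, ContDiffAt ℝ ∞ G x)
    (hXO : X.support ⊆ O) :
    (X.lipHomotopy hX hdX hsupp hF hG hη hclose ⊤).IsRectifiable := by
  -- the clamped homotopy is smooth on `(−2, 2) × O ⊇ [0,1] × spt X`
  have hO' : IsOpen (Set.Ioo (-2 : ℝ) 2 ×ˢ O) := isOpen_Ioo.prod hO
  have hΦO : ∀ p ∈ Set.Ioo (-2 : ℝ) 2 ×ˢ O, ContDiffAt ℝ ∞ (lipHomotopyMap F G) p := fun p hp =>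
    contDiffAt_lipHomotopyMap hp.1 (hFO _ hp.2) (hGO _ hp.2)
  have hKc : IsCompact (Set.Icc (0 : ℝ) 1 ×ˢ X.support) := isCompact_Icc.prod hsupp
  have hKO : Set.Icc (0 : ℝ) 1 ×ˢ X.support ⊆ Set.Ioo (-2 : ℝ) 2 ×ˢ O :=
    Set.prod_mono (fun t ht => ⟨by linarith [ht.1], by linarith [ht.2]⟩) hXO
  obtain ⟨Φ, U, hΦ, hΦc, hU, hKU, hEq⟩ := exists_contDiff_eqOn_nhds hO' hΦO hKc hKO
  obtain ⟨C, hΦlip⟩ := hΦ.lipschitzWith_of_hasCompactSupport hΦc (by simp)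
  -- `H(F,G) X = Φ_# ([0,1] × X)` computed with the product current's own cutoff
  set T := X.prodInterval 0 1 with hT
  have hTm := X.mass_prodInterval_ne_top hsupp hX
  have hTb := X.mass_boundary_prodInterval_ne_top hsupp hX hdX
  have hTc := X.isCompact_support_prodInterval hsupp 0 1
  have hTU : T.support ⊆ U := ((X.support_prodInterval_subset 0 1).trans (by
    rw [Set.uIcc_of_le zero_le_one])).trans hKU
  unfold Current.lipHomotopy
  rw [T.lipPushforward_congr hTm hTb hTc (lipschitzWith_lipHomotopyMap hF hG hη hclose) hΦlip hU hTU hEq,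
    T.lipPushforward_eq_pushforward hTm hTb hTc hΦlip hΦ]
  -- switch to a cutoff equal to `1` on a neighbourhood of `[0,1] × spt X`
  obtain ⟨χ₂, U₂, hU₂, hKU₂, hχ₂1, -⟩ := exists_testFunction_eq_one_nhds (Ω := cylinder (⊤ : Opens V)) hKc
    (fun p _ => by rw [coe_cylinder]; exact ⟨Set.mem_univ _, trivial⟩)
  obtain ⟨hU₁, hTU₁, hχ₁1, -⟩ := T.cutoff_spec hTc
  rw [T.pushforward_congr_cutoff (χ₁ := T.cutoff hTc) (χ₂ := χ₂) hΦ (hU₁.inter hU₂)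
    (Set.subset_inter hTU₁ (((X.support_prodInterval_subset 0 1).trans (by rw [Set.uIcc_of_le zero_le_one])).trans hKU₂))
    fun p hp => by rw [hχ₁1 p hp.1, hχ₂1 p hp.2]]
  exact hXr.pushforward_prodInterval_top χ₂ (fun p hp => hχ₂1 p (hKU₂ hp)) hΦ

/-- **The Lipschitz homotopy current is rectifiable when `F, G` are smooth off an `‖X‖`-null closed
set**: exhaust by `w = dist(·, V ∖ O) > s` at good levels; `H(F,G)(X ⌞ {w > s})` is rectifiable by the
previous lemma and `𝐌(H(F,G) X − H(F,G)(X ⌞ {w > s})) = 𝐌(H(F,G)(X ⌞ {w ≤ s})) ≤ c ‖X‖{w ≤ s} → 0`.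
[cite: Federer1969, 4.1.9, 4.1.24, 4.1.30] -/
theorem Current.IsRectifiable.lipHomotopy_of_null {X : Current (⊤ : Opens V) (m + 1)}
    (hXr : X.IsRectifiable) (hX : X.mass ≠ ⊤) (hdX : X.boundary.mass ≠ ⊤) (hsupp : IsCompact X.support)
    {F G : V → V'} {LF LG : ℝ≥0} (hF : LipschitzWith LF F) (hG : LipschitzWith LG G)
    {η : ℝ} (hη : 0 ≤ η) (hclose : ∀ x, ‖G x - F x‖ ≤ η)
    {O : Set V} (hO : IsOpen O) (hFO : ∀ x ∈ O, ContDiffAt ℝ ∞ F x) (hGO : ∀ x ∈ O, ContDiffAt ℝ ∞ G x)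
    (hnull : X.variation Oᶜ = 0) :
    (X.lipHomotopy hX hdX hsupp hF hG hη hclose ⊤).IsRectifiable := by
  rcases Set.eq_empty_or_nonempty Oᶜ with hOc | hOc
  · have hOu : O = Set.univ := by rwa [Set.compl_empty_iff] at hOc
    exact hXr.lipHomotopy_of_contDiffAt hX hdX hsupp hF hG hη hclose hO hFO hGO (by rw [hOu]; exact Set.subset_univ _)
  set w : V → ℝ := fun x => infDist x Oᶜ with hwdef
  have hw : LipschitzWith 1 w := lipschitz_infDist_pt Oᶜ
  have hwpos : ∀ {x}, 0 < w x → x ∈ O := fun {x} hx => by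
    by_contra hxO
    have : w x = 0 := infDist_zero_of_mem (show x ∈ Oᶜ from hxO)
    linarith
  have hw0 : {x | w x ≤ 0} ⊆ Oᶜ := fun x (hx : w x ≤ 0) => by
    have h0 : w x = 0 := le_antisymm hx infDist_nonneg
    have := (mem_closure_iff_infDist_zero hOc).2 h0
    rwa [hO.isClosed_compl.closure_eq] at this
  set hT := X.isRepresentable_of_mass_ne_top hX
  choose s hs hgood using fun j : ℕ => exists_good_level hX hdX hw (δ := 1 / ((j : ℝ) + 1)) (by positivity)
  set Xj : ℕ → Current (⊤ : Opens V) (m + 1) := fun j =>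
    hT.restrictSet {x | s j < w x} (measurableSet_lt_of_continuous hw.continuous (s j)) with hXj
  have hXjm : ∀ j, (Xj j).mass ≠ ⊤ := fun j => Current.mass_restrictSet_ne_top' _ hX _
  have hXjc : ∀ j, IsCompact (Xj j).support := fun j =>
    Current.isCompact_support_of_subset _ hsupp (Current.support_subset _) (hT.support_restrictSet_subset _)
  have hXjr : ∀ j, (Xj j).IsRectifiable := fun j => hXr.restrictSet_top hT _
  set Yj : ℕ → Current (⊤ : Opens V) (m + 1) := fun j =>
    hT.restrictSet {x | w x ≤ s j} (isClosed_le hw.continuous continuous_const).measurableSet with hYj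
  have hsplit : ∀ j, X = Xj j + Yj j := by
    intro j
    rw [hXj, hYj, ← hT.restrictSet_union]
    · conv_lhs => rw [← hT.restrictSet_univ]
      congr 1
      ext x; simp only [Set.mem_univ, Set.mem_union, Set.mem_setOf_eq, true_iff]; exact lt_or_ge _ _
    · exact Set.disjoint_left.2 fun x (hx : s j < w x) (hx' : w x ≤ s j) => (not_le.2 hx) hx'
  have hYjm : ∀ j, (Yj j).mass ≠ ⊤ := fun j => Current.mass_restrictSet_ne_top' _ hX _
  have hYjb : ∀ j, (Yj j).boundary.mass ≠ ⊤ := by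
    intro j
    have e : Yj j = X - Xj j := by rw [hsplit j]; abel
    rw [e, sub_eq_add_neg, Current.boundary_add, Current.boundary_neg]
    refine ne_top_of_le_ne_top (ENNReal.add_ne_top.2 ⟨hdX, ?_⟩) (Current.mass_add_le _ _)
    rw [Current.mass_neg]; exact hgood j
  have hYjc : ∀ j, IsCompact (Yj j).support := fun j =>
    Current.isCompact_support_of_subset _ hsupp (Current.support_subset _) (hT.support_restrictSet_subset _)
  -- the rectifiable approximants
  set Rj : ℕ → Current (⊤ : Opens V') (m + 1 + 1) := fun j =>
    (Xj j).lipHomotopy (hXjm j) (hgood j) (hXjc j) hF hG hη hclose ⊤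
  have hRjr : ∀ j, (Rj j).IsRectifiable := by
    intro j
    refine (hXjr j).lipHomotopy_of_contDiffAt (hXjm j) (hgood j) (hXjc j) hF hG hη hclose (O := {x | s j / 2 < w x})
      (isOpen_lt continuous_const hw.continuous) (fun x hx => hFO x (hwpos (lt_trans (half_pos (hs j).1) hx)))
      (fun x hx => hGO x (hwpos (lt_trans (half_pos (hs j).1) hx))) ?_
    refine (Current.IsRepresentable.support_restrictSet_subset_closure hT _).trans ?_
    refine (closure_minimal (fun x (hx : s j < w x) => show s j ≤ w x from hx.le)
      (isClosed_le continuous_const hw.continuous)).trans fun x hx => ?_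
    show s j / 2 < w x
    have : s j ≤ w x := hx
    linarith [(hs j).1]
  -- masses of the differences
  have hdiff : ∀ j, X.lipHomotopy hX hdX hsupp hF hG hη hclose ⊤ - Rj j =
      (Yj j).lipHomotopy (hYjm j) (hYjb j) (hYjc j) hF hG hη hclose ⊤ := by
    intro j
    have key := Current.lipHomotopy_add (Ω' := (⊤ : Opens V')) (T₁ := Xj j) (T₂ := Yj j)
      (hXjm j) (hgood j) (hXjc j) (hYjm j) (hYjb j) (hYjc j)
      (by rw [← hsplit j]; exact hX) (by rw [← hsplit j]; exact hdX) (by rw [← hsplit j]; exact hsupp) hF hG hη hclose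
    rw [sub_eq_iff_eq_add']
    refine Eq.trans ?_ key
    congr 1
    exact hsplit j
  set c : ℝ≥0∞ := ENNReal.ofReal (η * (5 * max (LF : ℝ) LG) ^ (m + 1)) with hc
  have hmass : ∀ j, (Rj j - X.lipHomotopy hX hdX hsupp hF hG hη hclose ⊤).mass ≤ c * X.variation {x | w x ≤ s j} := by
    intro j
    rw [Current.mass_sub_comm, hdiff j]
    refine (Current.mass_lipHomotopy_le _ _ (hYjb j) _ _ _ _ _).trans (mul_le_mul' le_rfl ?_)
    exact hT.mass_restrictSet_le _
  have hvar : Tendsto (fun j => X.variation {x | w x ≤ s j}) atTop (𝓝 0) := by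
    have hsub : ∀ j, X.variation {x | w x ≤ s j} ≤ X.variation {x | w x ≤ 1 / ((j : ℝ) + 1)} := fun j =>
      measure_mono fun x (hx : w x ≤ s j) => hx.trans (hs j).2.le
    have hanti : Antitone fun j : ℕ => {x : V | w x ≤ 1 / ((j : ℝ) + 1)} := by
      intro i j hij x (hx : w x ≤ 1 / ((j : ℝ) + 1))
      exact hx.trans (one_div_le_one_div_of_le (by positivity) (by exact_mod_cast Nat.add_le_add_right hij 1))
    have hlim := tendsto_measure_iInter_atTop (μ := X.variation)
      (fun j => (isClosed_le hw.continuous continuous_const).measurableSet.nullMeasurableSet) hanti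
      ⟨0, ne_top_of_le_ne_top hX (X.variation_le_mass _)⟩
    have hinter : ⋂ j : ℕ, {x : V | w x ≤ 1 / ((j : ℝ) + 1)} ⊆ Oᶜ := by
      refine Set.Subset.trans (fun x hx => ?_) hw0
      simp only [Set.mem_iInter, Set.mem_setOf_eq] at hx ⊢
      exact ge_of_tendsto' tendsto_one_div_add_atTop_nhds_zero_nat fun j => hx j
    have h0 : X.variation (⋂ j : ℕ, {x : V | w x ≤ 1 / ((j : ℝ) + 1)}) = 0 := measure_mono_null hinter hnull
    rw [h0] at hlim
    exact tendsto_of_tendsto_of_tendsto_of_le_of_le tendsto_const_nhds hlim (fun j => bot_le) hsub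
  have hlim : Tendsto (fun j => (Rj j - X.lipHomotopy hX hdX hsupp hF hG hη hclose ⊤).mass) atTop (𝓝 0) := by
    have := ENNReal.Tendsto.const_mul (a := c) hvar (Or.inr ENNReal.ofReal_ne_top)
    rw [mul_zero] at this
    exact tendsto_of_tendsto_of_tendsto_of_le_of_le tendsto_const_nhds this (fun j => bot_le) hmass
  -- a common compact set containing the supports
  obtain ⟨ρ, hρ0, hρ⟩ := hsupp.isBounded.subset_closedBall_lt 0 0
  obtain ⟨Cl, hΦl⟩ : ∃ Cl, LipschitzWith Cl (lipHomotopyMap F G) := ⟨_, lipschitzWith_lipHomotopyMap hF hG hη hclose⟩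
  set K : Set V' := closedBall (lipHomotopyMap F G ((0 : ℝ), (0 : V))) (Cl * (ρ + 2)) with hK
  have hKc : IsCompact K := isCompact_closedBall _ _
  have hmaps : Set.MapsTo (lipHomotopyMap F G) (Set.univ ×ˢ ball (0 : V) (ρ + 1) ∩ ball 0 (ρ + 2)) K := by
    intro p hp
    rw [hK, mem_closedBall]
    calc dist (lipHomotopyMap F G p) (lipHomotopyMap F G ((0 : ℝ), (0 : V))) ≤ Cl * dist p ((0 : ℝ), (0 : V)) :=
          hΦl.dist_le_mul _ _
      _ ≤ Cl * (ρ + 2) := by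
          refine mul_le_mul_of_nonneg_left ?_ Cl.coe_nonneg
          have := mem_ball.1 hp.2
          rw [show ((0 : ℝ), (0 : V)) = (0 : ℝ × V) from rfl]
          exact this.le
  have hRjK : ∀ j, (Rj j).support ⊆ K := by
    intro j
    refine Current.support_lipPushforward_subset_of_mapsTo _ _ _ _ _ (isOpen_univ.prod isOpen_ball |>.inter isOpen_ball)
      (fun p hp => ?_) hKc.isClosed hmaps
    have hp' := (Xj j).support_prodInterval_subset 0 1 hp
    rw [Set.uIcc_of_le zero_le_one] at hp'
    have hx : p.2 ∈ ball (0 : V) (ρ + 1) :=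
      (closedBall_subset_ball (by linarith)) (hρ (hT.support_restrictSet_subset _ hp'.2))
    refine ⟨⟨Set.mem_univ _, hx⟩, ?_⟩
    rw [mem_ball, Prod.dist_eq, show ((0 : ℝ × V)) = ((0 : ℝ), (0 : V)) from rfl]
    refine max_lt ?_ ?_
    · rw [Real.dist_eq, sub_zero]; exact lt_of_le_of_lt (abs_le.2 ⟨by linarith [hp'.1.1], hp'.1.2⟩) (by linarith)
    · have := mem_ball.1 hx; linarith
  exact Current.IsRectifiable.of_tendsto_mass hKc Rj hRjr hRjK hlim

end LipHomotopyRect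

/-! ### Rectifiability of the admissible homotopy -/

section AdmissibleHomotopyRectifiable

open Cubical

variable {V : Type*} [NormedAddCommGroup V] [InnerProductSpace ℝ V] [FiniteDimensional ℝ V]
  [MeasurableSpace V] [BorelSpace V] {n d : ℕ} {v : V → ℝ} {g₁ g₂ : V → V} {C : ℝ}
  {S : Current (⊤ : Opens V) (d + 1)}

variable (b : OrthonormalBasis (Fin n) ℝ V) (hS : S.mass ≠ ⊤) (hsupp : IsCompact S.support)
  (hv : Continuous v) (h₁ : Admissible v g₁ C) (h₂ : Admissible v g₂ C) (hC : 0 ≤ C)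
  {η₀ : ℝ} (hη₀ : 0 ≤ η₀) (hclose : ∀ x, 0 < v x → ‖g₂ x - g₁ x‖ ≤ η₀)

/-- **`H_r = H(G¹_r, G²_r)(S ⌞ {v > r})` is rectifiable** when `S` is and `g₁, g₂` are smooth at the
points of an open `O` with `‖S‖(V ∖ O) = 0` (the extensions agree with `gᵢ` on the open set
`{v > r/2}`). [cite: Federer1969, 4.1.30, 4.2.2] -/
theorem Current.IsRectifiable.admHom (hSr : S.IsRectifiable) {O : Set V} (hO : IsOpen O)
    (hg₁O : ∀ x ∈ O, ContDiffAt ℝ ∞ g₁ x) (hg₂O : ∀ x ∈ O, ContDiffAt ℝ ∞ g₂ x) (hnull : S.variation Oᶜ = 0)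
    {r : ℝ} (hr : 0 < r) (hgood : (S.restrictAbove hS hv r).boundary.mass ≠ ⊤) :
    (S.admHom b hS hsupp hv h₁ h₂ hC hη₀ hclose hr hgood).IsRectifiable := by
  set hT := S.isRepresentable_of_mass_ne_top hS
  have hXr : (S.restrictAbove hS hv r).IsRectifiable := hSr.restrictSet_top hT _
  unfold Current.admHom
  refine hXr.lipHomotopy_of_null (S.mass_restrictAbove_ne_top hS hv r) hgood
    (S.isCompact_support_restrictAbove hS hsupp hv r) _ _ _ _ (O := O ∩ {x | r / 2 < v x})
    (hO.inter (isOpen_lt continuous_const hv)) (fun x hx => ?_) (fun x hx => ?_) ?_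
  · refine (hg₁O x hx.1).congr_of_eventuallyEq ?_
    filter_upwards [(isOpen_lt continuous_const hv).mem_nhds hx.2] with y hy
    exact h₁.ext_eqOn b hC hr (show r / 2 ≤ v y from le_of_lt hy)
  · refine (hg₂O x hx.1).congr_of_eventuallyEq ?_
    filter_upwards [(isOpen_lt continuous_const hv).mem_nhds hx.2] with y hy
    exact h₁.ext₂_eqOn b h₂ hC hη₀ hclose hr (show r / 2 ≤ v y from le_of_lt hy)
  · unfold Current.restrictAbove
    rw [hT.variation_restrictSet_eq hS _ (measurableSet_lt_of_continuous hv r),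
      Measure.restrict_apply' (measurableSet_lt_of_continuous hv r)]
    refine measure_mono_null (fun x hx => ?_) hnull
    simp only [Set.mem_inter_iff, Set.mem_compl_iff, Set.mem_setOf_eq, not_and, not_lt] at hx ⊢
    intro hxO
    have := hx.1 hxO
    linarith [hx.2]

/-- Support of `H_r` from a bounded localisation: if the segments `[g₁ x, g₂ x]`, `x ∈ {v > 0} ∩ B`
(`B` open, `spt S ⊆ B`), lie in a closed `Z`, then `spt H_r ⊆ Z` (for `ε ∈ (0,1]` the clamped
homotopy maps the open set `(−ε, 1+ε) × ({v > r/2} ∩ B) ⊇ spt([0,1] × S ⌞ {v > r})` into the closed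
`ε η₀`-thickening of `Z`). [cite: Federer1969, 4.2.2] -/
theorem Current.support_admHom_subset {r : ℝ} (hr : 0 < r)
    (hgood : (S.restrictAbove hS hv r).boundary.mass ≠ ⊤) {B : Set V} (hB : IsOpen B) (hSB : S.support ⊆ B)
    {Z : Set V} (hZ : IsClosed Z)
    (hgZ : ∀ t ∈ Set.Icc (0 : ℝ) 1, ∀ x ∈ {x | 0 < v x} ∩ B, g₁ x + t • (g₂ x - g₁ x) ∈ Z) :
    (S.admHom b hS hsupp hv h₁ h₂ hC hη₀ hclose hr hgood).support ⊆ Z := by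
  set X := S.restrictAbove hS hv r
  have hXB : X.support ⊆ {x | r / 2 < v x} ∩ B := Set.subset_inter
    ((S.support_restrictAbove_subset hS hv r).trans fun x hx => by
      show r / 2 < v x
      have : r ≤ v x := hx
      linarith)
    (((S.isRepresentable_of_mass_ne_top hS).support_restrictSet_subset _).trans hSB)
  -- for every `ε ∈ (0,1]`, the support lies in the `ε η₀`-thickening of `Z`
  have hthick : ∀ ε : ℝ, 0 < ε → ε ≤ 1 →
      (S.admHom b hS hsupp hv h₁ h₂ hC hη₀ hclose hr hgood).support ⊆ cthickening (ε * η₀) Z := by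
    intro ε hε hε1
    unfold Current.admHom Current.lipHomotopy
    refine Current.support_lipPushforward_subset_of_mapsTo _ _ _ _ _
      (N := Set.Ioo (-ε) (1 + ε) ×ˢ ({x | r / 2 < v x} ∩ B))
      (isOpen_Ioo.prod ((isOpen_lt continuous_const hv).inter hB))
      ((X.support_prodInterval_subset 0 1).trans ?_) (isClosed_cthickening (δ := ε * η₀) (E := Z)) fun p hp => ?_
    · rw [Set.uIcc_of_le zero_le_one]
      exact Set.prod_mono (fun t ht => ⟨by linarith [ht.1], by linarith [ht.2]⟩) hXB
    · obtain ⟨⟨ht1, ht2⟩, hx, hxB⟩ := hp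
      have hvx : 0 < v p.2 := lt_of_le_of_lt (by positivity) hx
      have heq : lipHomotopyMap (h₁.ext b hC hr) (h₁.ext₂ b h₂ hC hη₀ hclose hr) p =
          g₁ p.2 + p.1 • (g₂ p.2 - g₁ p.2) := by
        rw [lipHomotopyMap_eq_affineHomotopy _ _ (abs_le.2 ⟨by linarith, by linarith⟩)]
        unfold affineHomotopy
        rw [h₁.ext_eqOn b hC hr (show r / 2 ≤ v p.2 from le_of_lt hx),
          h₁.ext₂_eqOn b h₂ hC hη₀ hclose hr (show r / 2 ≤ v p.2 from le_of_lt hx)]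
      rw [heq]
      set t' : ℝ := max 0 (min 1 p.1) with ht'
      have ht'I : t' ∈ Set.Icc (0 : ℝ) 1 := ⟨le_max_left _ _, max_le zero_le_one (min_le_left _ _)⟩
      have hdt : |p.1 - t'| ≤ ε := by
        rw [abs_le, ht']
        constructor
        · rcases le_total 0 (min 1 p.1) with h | h
          · rw [max_eq_right h]
            rcases le_total 1 p.1 with h' | h'
            · rw [min_eq_left h']; linarith
            · rw [min_eq_right h']; linarith
          · rw [max_eq_left h]; have := min_le_right 1 p.1; linarith [min_le_iff.1 h |>.elim (fun h => absurd h (by norm_num)) id]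
        · rcases le_total 0 (min 1 p.1) with h | h
          · rw [max_eq_right h]
            rcases le_total 1 p.1 with h' | h'
            · rw [min_eq_left h']; linarith
            · rw [min_eq_right h']; linarith
          · rw [max_eq_left h]; linarith [min_le_iff.1 h |>.elim (fun h => absurd h (by norm_num)) id]
      refine Metric.mem_cthickening_of_dist_le _ (g₁ p.2 + t' • (g₂ p.2 - g₁ p.2)) _ _ (hgZ t' ht'I p.2 ⟨hvx, hxB⟩) ?_
      rw [dist_eq_norm, add_sub_add_left_eq_sub, ← sub_smul, norm_smul, Real.norm_eq_abs]
      exact mul_le_mul hdt (hclose _ hvx) (norm_nonneg _) hε.le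
  -- hence in `Z = ⋂_ε cthickening (ε η₀) Z`
  intro y hy
  rw [← hZ.closure_eq, Metric.closure_eq_iInter_cthickening]
  simp only [Set.mem_iInter]
  intro δ hδ
  by_cases hη : η₀ = 0
  · have := hthick 1 one_pos le_rfl hy
    rw [hη, mul_zero] at this
    exact cthickening_mono hδ.le _ this
  · have hη' : 0 < η₀ := lt_of_le_of_ne hη₀ (Ne.symm hη)
    have h := hthick (min 1 (δ / η₀)) (lt_min one_pos (div_pos hδ hη')) (min_le_left _ _) hy
    refine cthickening_mono ?_ _ h
    calc min 1 (δ / η₀) * η₀ ≤ δ / η₀ * η₀ := mul_le_mul_of_nonneg_right (min_le_right _ _) hη₀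
      _ = δ := div_mul_cancel₀ _ hη

variable {ε : ℝ} (hε : 0 < ε) {P : ℝ → Prop} (R : S.GoodSeq hS hv ε P) (hvε : ∀ x, v x ≤ ε)
  (hI : ∫⁻ x, admWeight v d x ∂S.variation ≠ ⊤)

/-- Support of `H_v(g₁, g₂) S` from a bounded localisation. [cite: Federer1969, 4.2.2] -/
theorem Current.support_admHomLim_subset {B : Set V} (hB : IsOpen B) (hSB : S.support ⊆ B)
    {Z : Set V} (hZ : IsClosed Z)
    (hgZ : ∀ t ∈ Set.Icc (0 : ℝ) 1, ∀ x ∈ {x | 0 < v x} ∩ B, g₁ x + t • (g₂ x - g₁ x) ∈ Z) :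
    (S.admHomLim b hS hsupp hv h₁ h₂ hC hη₀ hclose hε R hvε hI).support ⊆ Z :=
  (S.admHomFamily b hS hsupp hv h₁ h₂ hC hη₀ hclose).support_lim_subset hε R hI hvε hZ fun j =>
    S.support_admHom_subset b hS hsupp hv h₁ h₂ hC hη₀ hclose (R.pos hε j) (R.good j) hB hSB hZ hgZ

/-- **The admissible homotopy `H_v(g₁, g₂) S` of a rectifiable `S` is rectifiable** when `g₁, g₂`
are smooth at the points of an open `O` with `‖S‖(V ∖ O) = 0` and the segments `[g₁ x, g₂ x]`,
`x ∈ {v > 0} ∩ B` (`B ⊇ spt S` open), stay in a fixed compact `K`: the currents `H_{r_j}` are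
rectifiable with supports in `K` and `Σ 𝐌(H_{r_{j+1}} − H_{r_j}) < ∞`, so their `𝐌`-limit is
rectifiable and equals the weak limit. [cite: Federer1969, 4.1.24, 4.1.30, 4.2.2] -/
theorem Current.IsRectifiable.admHomLim (hSr : S.IsRectifiable) {O : Set V} (hO : IsOpen O)
    (hg₁O : ∀ x ∈ O, ContDiffAt ℝ ∞ g₁ x) (hg₂O : ∀ x ∈ O, ContDiffAt ℝ ∞ g₂ x) (hnull : S.variation Oᶜ = 0)
    {B : Set V} (hB : IsOpen B) (hSB : S.support ⊆ B) {K : Set V} (hK : IsCompact K)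
    (hgK : ∀ t ∈ Set.Icc (0 : ℝ) 1, ∀ x ∈ {x | 0 < v x} ∩ B, g₁ x + t • (g₂ x - g₁ x) ∈ K) :
    (S.admHomLim b hS hsupp hv h₁ h₂ hC hη₀ hclose hε R hvε hI).IsRectifiable := by
  set F := S.admHomFamily b hS hsupp hv h₁ h₂ hC hη₀ hclose
  have hseq : ∀ j, F.seq hε R j = S.admHom b hS hsupp hv h₁ h₂ hC hη₀ hclose (R.pos hε j) (R.good j) :=
    fun j => rfl
  have hrect : ∀ j, (F.seq hε R j).IsRectifiable := fun j =>
    hSr.admHom b hS hsupp hv h₁ h₂ hC hη₀ hclose hO hg₁O hg₂O hnull (R.pos hε j) (R.good j)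
  have hsuppK : ∀ j, (F.seq hε R j).support ⊆ K := fun j =>
    S.support_admHom_subset b hS hsupp hv h₁ h₂ hC hη₀ hclose (R.pos hε j) (R.good j) hB hSB hK.isClosed hgK
  have htsum : ∑' j, (F.seq hε R (j + 1) - F.seq hε R j).mass ≠ ⊤ :=
    ne_top_of_le_ne_top (ENNReal.mul_ne_top F.K_ne_top hI) (F.tsum_mass_seq_sub_le hε R)
  obtain ⟨T', hT'r, -, hlim⟩ := Current.IsRectifiable.exists_limit_of_tsum_mass_ne_top hK _ hrect hsuppK htsum
  have heq : S.admHomLim b hS hsupp hv h₁ h₂ hC hη₀ hclose hε R hvε hI = T' := by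
    ext φ
    have t1 := S.tendsto_admHom b hS hsupp hv h₁ h₂ hC hη₀ hclose hε R hvε hI φ
    obtain ⟨Cφ, hCφ, hφ⟩ := φ.exists_norm_le
    have hev : ∀ᶠ j in atTop, (F.seq hε R j - T').mass < 1 := hlim (Iio_mem_nhds one_pos)
    have t2 : Tendsto (fun j => F.seq hε R j φ - T' φ) atTop (𝓝 0) := by
      have hlim' : Tendsto (fun j => Cφ * (F.seq hε R j - T').mass.toReal) atTop (𝓝 0) := by
        have := ((ENNReal.tendsto_toReal ENNReal.zero_ne_top).comp hlim).const_mul Cφ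
        simpa using this
      refine squeeze_zero_norm' ?_ hlim'
      filter_upwards [hev] with j hj
      rw [Real.norm_eq_abs]
      have := (F.seq hε R j - T').abs_apply_le_mul_toReal_mass hj.ne_top hCφ hφ
      simpa using this
    have t2' : Tendsto (fun j => F.seq hε R j φ) atTop (𝓝 (T' φ)) := by
      have := t2.add_const (T' φ)
      simpa using this
    simp only [hseq] at t2'
    exact tendsto_nhds_unique t1 t2'
  rw [heq]; exact hT'r

end AdmissibleHomotopyRectifiable

end Literature.Geometry.GeometricMeasureTheory
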